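import Summits.CriticalPhenomena.PercolationContinuityZ3.Theorems.PercNearOneGluingNoHeavyLowerTailAPLLadderApex
import HarnessLib

/-!
# `NoHeavyLowerTail` (stmt-CriticalPhenomena-4575) — PENDANT APEX: intermediate attachment strengths never help
# (`E(ε) ≤ max(DV²(g), E(g))`, convexity in the apex weight)

Support file (prover prim-ineq-gen-8 gen 62; `--supports stmt-CriticalPhenomena-4575`; memo
run/shared/lean/prim/prim-ineq-gen-8/FINDING-gen62-BEYONDSP.md §2).  No definitions, no named facts, no sorries.

If the apex `o` hangs at a core vertex `g` by one edge of weight `ε ∈ [0,1]`, the numbers of `(o; u, v)` are `(εp, επ, ετ, s − ετ)` in terms of the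
core numbers `p = P(u ∈ cl g)`, `π = P(v ∈ cl g)`, `τ = P(u, v ∈ cl g)`, `s = P(v ∈ cl u) = m + τ` (`pendant_apex_numbers`), so
`E(ε) = (τ − εpπ)²/(pπ(s − ετ))`.  The function `ε ↦ (τ − εpπ)² − C·pπ·(s − ετ)` is CONVEX, hence `E(ε) ≤ C` for all `ε ∈ [0,1]` as soon as it
holds at the two ends: `ε → 0` is the three-point ratio `DV² = τ²/(pπs) ≤ C` of the core and `ε = 1` (the apex glued onto `g`) is `E(g; u, v) ≤ C`.
* `pendant_convex` — the real-variable lemma.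
* **`pendant_E_le`** — graph form: `o` off the core `R`, edge `s(o,g)` of any weight in `[0,1]`; if `(g; u, v)` on `R` satisfies
  `τ² ≤ C·pπ·s` and `(τ − pπ)² ≤ C·pπ·m` then `(o; u, v)` on `insert s(o,g) R` satisfies `κ² ≤ C·pπm`.
So for a pendant apex only the WEAK limit (`DV²`) and the FULL attachment (`o = g`) matter — the reduction used throughout the `beyond SP`
analysis (memo §2), now at the `PrW` level for every finite weighted graph. [this work]
-/

namespace Summit.CriticalPhenomena.PercolationContinuityZ3.Theorems

namespace APL

open Literature.Probability.Percolation Literature.Probability.Percolation.Gladkov Literature.Probability.Percolation.DecisionTree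
open scoped Classical

variable {V : Type*} [Fintype V]

/-- Convexity in the apex weight: if `τ² ≤ C·p·π·s` (`ε = 0`) and `(τ − pπ)² ≤ C·p·π·(s − τ)` (`ε = 1`) with `p, π ≥ 0`, then
`(ετ − (εp)(επ))² ≤ C·(εp)(επ)·(s − ετ)` for every `ε ∈ [0,1]` (the difference of the two sides of `(τ − εpπ)² ≤ C pπ (s − ετ)` is a convex
quadratic in `ε`). [this work] -/
theorem pendant_convex (C p q τ s ε : ℝ) (hp : 0 ≤ p) (hq : 0 ≤ q) (hε0 : 0 ≤ ε) (hε1 : ε ≤ 1)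
    (h0 : τ ^ 2 ≤ C * p * q * s) (h1 : (τ - p * q) ^ 2 ≤ C * p * q * (s - τ)) :
    (ε * τ - ε * p * (ε * q)) ^ 2 ≤ C * (ε * p) * (ε * q) * (s - ε * τ) := by
  -- φ(ε) = (τ − εP)² − C P (s − ετ), P = pq, is convex with φ(0), φ(1) ≤ 0, so φ(ε) ≤ (1−ε)φ(0) + εφ(1) ≤ 0
  have hP : 0 ≤ p * q := mul_nonneg hp hq
  have key : (τ - ε * (p * q)) ^ 2 - C * (p * q) * (s - ε * τ)
      ≤ (1 - ε) * (τ ^ 2 - C * p * q * s) + ε * ((τ - p * q) ^ 2 - C * p * q * (s - τ)) := by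
    nlinarith [mul_nonneg (mul_nonneg hε0 (sub_nonneg.2 hε1)) (sq_nonneg (p * q))]
  have h2 : (1 - ε) * (τ ^ 2 - C * p * q * s) ≤ 0 := mul_nonpos_of_nonneg_of_nonpos (sub_nonneg.2 hε1) (sub_nonpos.2 h0)
  have h3 : ε * ((τ - p * q) ^ 2 - C * p * q * (s - τ)) ≤ 0 := mul_nonpos_of_nonneg_of_nonpos hε0 (sub_nonpos.2 h1)
  have hφ : (τ - ε * (p * q)) ^ 2 ≤ C * (p * q) * (s - ε * τ) := by linarith
  have e1 : (ε * τ - ε * p * (ε * q)) ^ 2 = ε ^ 2 * (τ - ε * (p * q)) ^ 2 := by ring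
  have e2 : C * (ε * p) * (ε * q) * (s - ε * τ) = ε ^ 2 * (C * (p * q) * (s - ε * τ)) := by ring
  rw [e1, e2]
  exact mul_le_mul_of_nonneg_left hφ (sq_nonneg ε)

/-- **Pendant apex: only the weak limit and the full attachment matter.**  Let the apex `o` hang at `g` by the single edge `s(o, g)` (any
weight in `[0,1]`; `o` off the core `R`; ports `u, v ≠ o`).  If on the core the three-point ratio satisfies `P(u,v ∈ cl g)² ≤ C·P(u ∈ cl g)·
P(v ∈ cl g)·P(v ∈ cl u)` (`DV² ≤ C`) and `g` as an apex satisfies `(P(u,v ∈ cl g) − P(u ∈ cl g)P(v ∈ cl g))² ≤ C·P(u ∈ cl g)P(v ∈ cl g)·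
P(u ∉ cl g, v ∈ cl u)` (`E(g; u, v) ≤ C`), then `(o; u, v)` on `insert s(o,g) R` satisfies `E ≤ C`:
`(P(u,v ∈ cl o) − P(u ∈ cl o)P(v ∈ cl o))² ≤ C·P(u ∈ cl o)·P(v ∈ cl o)·P(u ∉ cl o, v ∈ cl u)`.  (For two-terminal series–parallel cores
both hypotheses hold with `C = 28/27`: `sp_threePoint_le'`, `sp_E_le`.) [this work] -/
theorem pendant_E_le (p : Sym2 V → ℝ) (hp0 : ∀ e, 0 ≤ p e) (hp1 : ∀ e, p e ≤ 1) (R : Finset (Sym2 V)) (o g u v : V) (hog : o ≠ g)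
    (huo : u ≠ o) (hvo : v ≠ o) (hR : ∀ f ∈ R, o ∉ f) (C : ℝ)
    (hDV : PrW R p {K : Finset (Sym2 V) | u ∈ cl K g ∧ v ∈ cl K g} ^ 2
        ≤ C * PrW R p {K : Finset (Sym2 V) | u ∈ cl K g} * PrW R p {K : Finset (Sym2 V) | v ∈ cl K g} * PrW R p {K : Finset (Sym2 V) | v ∈ cl K u})
    (hE : (PrW R p {K : Finset (Sym2 V) | u ∈ cl K g ∧ v ∈ cl K g}
        - PrW R p {K : Finset (Sym2 V) | u ∈ cl K g} * PrW R p {K : Finset (Sym2 V) | v ∈ cl K g}) ^ 2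
        ≤ C * PrW R p {K : Finset (Sym2 V) | u ∈ cl K g} * PrW R p {K : Finset (Sym2 V) | v ∈ cl K g}
          * PrW R p {K : Finset (Sym2 V) | u ∉ cl K g ∧ v ∈ cl K u}) :
    (PrW (insert s(o, g) R) p {K : Finset (Sym2 V) | u ∈ cl K o ∧ v ∈ cl K o}
        - PrW (insert s(o, g) R) p {K : Finset (Sym2 V) | u ∈ cl K o} * PrW (insert s(o, g) R) p {K : Finset (Sym2 V) | v ∈ cl K o}) ^ 2
      ≤ C * PrW (insert s(o, g) R) p {K : Finset (Sym2 V) | u ∈ cl K o} * PrW (insert s(o, g) R) p {K : Finset (Sym2 V) | v ∈ cl K o}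
        * PrW (insert s(o, g) R) p {K : Finset (Sym2 V) | u ∉ cl K o ∧ v ∈ cl K u} := by
  obtain ⟨ap, aπ, aτ, am⟩ := pendant_apex_numbers p R o g u v hog huo hvo hR
  have hs := pendant_split_bc' p R g u v
  rw [← m_event_eq_cell p R g u v] at hs
  rw [hs] at hDV
  rw [ap, aπ, aτ, am]
  have hP1 : 0 ≤ PrW R p {K : Finset (Sym2 V) | u ∈ cl K g} := PrW_nonneg R hp0 hp1 _
  have hP2 : 0 ≤ PrW R p {K : Finset (Sym2 V) | v ∈ cl K g} := PrW_nonneg R hp0 hp1 _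
  have key := pendant_convex C (PrW R p {K : Finset (Sym2 V) | u ∈ cl K g}) (PrW R p {K : Finset (Sym2 V) | v ∈ cl K g})
    (PrW R p {K : Finset (Sym2 V) | u ∈ cl K g ∧ v ∈ cl K g})
    (PrW R p {K : Finset (Sym2 V) | u ∉ cl K g ∧ v ∈ cl K u} + PrW R p {K : Finset (Sym2 V) | u ∈ cl K g ∧ v ∈ cl K g})
    (p s(o, g)) hP1 hP2 (hp0 _) (hp1 _) hDV (by
      have e : PrW R p {K : Finset (Sym2 V) | u ∉ cl K g ∧ v ∈ cl K u} + PrW R p {K : Finset (Sym2 V) | u ∈ cl K g ∧ v ∈ cl K g}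
          - PrW R p {K : Finset (Sym2 V) | u ∈ cl K g ∧ v ∈ cl K g} = PrW R p {K : Finset (Sym2 V) | u ∉ cl K g ∧ v ∈ cl K u} := by ring
      rw [e]; exact hE)
  convert key using 2

end APL

end Summit.CriticalPhenomena.PercolationContinuityZ3.Theorems
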